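import Mathlib
import Summits.ValiantsHypothesis.ValiantsHypothesis.Theses.BarrierLever
import Summits.ValiantsHypothesis.ValiantsHypothesis.Theorems.BarrierLeverDefinableEquationsDefs
import Summits.ValiantsHypothesis.ValiantsHypothesis.Theorems.BarrierLeverDefinableEquationsTopEquations

/-!
# Crux `BarrierLever.DefinableEquations` (stmt-ValiantsHypothesis-8745) — normal form, continued:
# the crux is a statement about the variety of FORMS of small circuit size (lead c6)

`FormEq(n, b, a)`: some level-`a` boolean sum (`q ≤ N^a`, `L(H), deg H ≤ N^a`, `N = C(2n,n)`) in
the coefficient variables `topMonomials n` of `Sym^n ℂ^n` is nonzero and vanishes at `coeff(g)`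
for every HOMOGENEOUS degree-`n` form `g ∈ SmallCircuits ℂ n b` — a VNP(N)-natural proof against
homogeneous size-`n^b` circuits for `n`-ary `n`-ics, nothing else.

THEOREM (`definableEquations_iff_formEquations`, registered sub-goal).
`DefinableEquations ↔ ∃ a ∀ b ∃ n₀ ∀ n ≥ n₀, FormEq(n, b, a)`.

Through the top-component normal form of `…TopEquations.lean` (`TopEq`: vanishing at the top
component of EVERY `f ∈ SmallCircuits ℂ n b`): `TopEq(n, b, a) → FormEq(n, b, a)` trivially (a form
is its own top component), and `FormEq(n, b+3, a) → TopEq(n, b, a)` for `n ≥ 6` because the top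
component of a small `f` is a small form (`SqrtCheap.complexity_homogeneousComponent_le`:
`L(f_n) ≤ (n+1)(L(f)+n+2) ≤ n^(b+3)`) with the same top coefficients.  So the crux reads, finally:

  ONE level `a` such that for EVERY `b`, eventually in `n`, the cone
  `Forms_n(n^b) = {g ∈ Sym^n ℂ^n : L(g) ≤ n^b}` has a nonzero equation that is a level-`a`
  boolean sum in its `C(2n-1, n)` coefficients.

Pure bookkeeping; no definitions, no facts.
-/

set_option linter.dupNamespace false

noncomputable section

namespace Summit.ValiantsHypothesis.ValiantsHypothesis.Theorems.BarrierLeverDefinableEquations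

open MvPolynomial
open Literature.Computability.AlgebraicComplexity Literature.Barriers.ValiantsHypothesis
open scoped BigOperators

namespace FormEquations

/-- Arithmetic: for `n ≥ 6`, `(n+1)(n^b + n + 2) ≤ n^(b+3)`. [folklore] -/
theorem form_arith {n b : ℕ} (hn : 6 ≤ n) : (n + 1) * (n ^ b + n + 2) ≤ n ^ (b + 3) := by
  have hpos : 1 ≤ n ^ b := Nat.one_le_pow _ _ (by omega)
  have h1 : n ≤ n * n ^ b := by
    calc n = n * 1 := (mul_one n).symm
      _ ≤ n * n ^ b := Nat.mul_le_mul_left _ hpos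
  have hA : n + 1 ≤ 2 * n := by omega
  have hB : n ^ b + n + 2 ≤ n ^ b + 2 * (n * n ^ b) := by omega
  have hC : 2 + 4 * n ≤ n * n := by nlinarith
  calc (n + 1) * (n ^ b + n + 2) ≤ (2 * n) * (n ^ b + 2 * (n * n ^ b)) := Nat.mul_le_mul hA hB
    _ = (2 + 4 * n) * (n * n ^ b) := by ring
    _ ≤ (n * n) * (n * n ^ b) := Nat.mul_le_mul_right _ hC
    _ = n ^ (b + 3) := by ring

/-- The top component of a small polynomial is a small FORM with the same top coefficients:
for `n ≥ 6` and `f ∈ SmallCircuits ℂ n b`, `f_n ∈ SmallCircuits ℂ n (b+3)`, `f_n` is homogeneous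
of degree `n`, and `coeff_e f_n = coeff_e f` for `|e| = n`. [folklore] -/
theorem exists_form {n b : ℕ} (hn : 6 ≤ n) (f : MvPolynomial (Fin n) ℂ)
    (hf : f ∈ SmallCircuits ℂ n b) :
    ∃ g ∈ SmallCircuits ℂ n (b + 3), g.IsHomogeneous n ∧
      ∀ e : ↥(topMonomials n), coeff (e : Fin n →₀ ℕ) g = coeff (e : Fin n →₀ ℕ) f := by
  obtain ⟨hfdeg, hfc⟩ := hf
  refine ⟨homogeneousComponent n f, ⟨?_, ?_⟩, homogeneousComponent_isHomogeneous n f, fun e => ?_⟩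
  · exact (homogeneousComponent_isHomogeneous n f).totalDegree_le
  · have h1 := Summit.ValiantsHypothesis.ValiantsHypothesis.Theorems.DivisionGapZeroOneTransfer.SqrtCheap.complexity_homogeneousComponent_le
      f hfdeg n
    rw [Fintype.card_fin] at h1
    refine h1.trans ?_
    calc (n + 1) * (complexity f + n + 2) ≤ (n + 1) * (n ^ b + n + 2) := by gcongr
      _ ≤ n ^ (b + 3) := form_arith hn
  · rw [coeff_homogeneousComponent, if_pos (show (e : Fin n →₀ ℕ).degree = n from e.2)]

/-- `TopEq(n, b, a) → FormEq(n, b, a)` (restrict to homogeneous inputs). [folklore] -/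
theorem formEq_of_topEq {a b n : ℕ}
    (h : ∃ q : ℕ, q ≤ (Nat.choose (2 * n) n) ^ a ∧
      ∃ H : MvPolynomial (↥(topMonomials n) ⊕ Fin q) ℂ,
        complexity H ≤ (Nat.choose (2 * n) n) ^ a ∧ H.totalDegree ≤ (Nat.choose (2 * n) n) ^ a ∧
        boolSum H ≠ 0 ∧
        ∀ f ∈ SmallCircuits ℂ n b,
          eval (fun e : topMonomials n => coeff (e : Fin n →₀ ℕ) f) (boolSum H) = 0) :
    ∃ q : ℕ, q ≤ (Nat.choose (2 * n) n) ^ a ∧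
      ∃ H : MvPolynomial (↥(topMonomials n) ⊕ Fin q) ℂ,
        complexity H ≤ (Nat.choose (2 * n) n) ^ a ∧ H.totalDegree ≤ (Nat.choose (2 * n) n) ^ a ∧
        boolSum H ≠ 0 ∧
        ∀ g ∈ SmallCircuits ℂ n b, g.IsHomogeneous n →
          eval (fun e : topMonomials n => coeff (e : Fin n →₀ ℕ) g) (boolSum H) = 0 := by
  obtain ⟨q, hq, H, hHc, hHd, hne, hvan⟩ := h
  exact ⟨q, hq, H, hHc, hHd, hne, fun g hg _ => hvan g hg⟩

/-- `FormEq(n, b+3, a) → TopEq(n, b, a)` for `n ≥ 6` (the top component of a small `f` is a small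
form with the same top coefficients, `exists_form`). [folklore] -/
theorem topEq_of_formEq {a b n : ℕ} (hn : 6 ≤ n)
    (h : ∃ q : ℕ, q ≤ (Nat.choose (2 * n) n) ^ a ∧
      ∃ H : MvPolynomial (↥(topMonomials n) ⊕ Fin q) ℂ,
        complexity H ≤ (Nat.choose (2 * n) n) ^ a ∧ H.totalDegree ≤ (Nat.choose (2 * n) n) ^ a ∧
        boolSum H ≠ 0 ∧
        ∀ g ∈ SmallCircuits ℂ n (b + 3), g.IsHomogeneous n →
          eval (fun e : topMonomials n => coeff (e : Fin n →₀ ℕ) g) (boolSum H) = 0) :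
    ∃ q : ℕ, q ≤ (Nat.choose (2 * n) n) ^ a ∧
      ∃ H : MvPolynomial (↥(topMonomials n) ⊕ Fin q) ℂ,
        complexity H ≤ (Nat.choose (2 * n) n) ^ a ∧ H.totalDegree ≤ (Nat.choose (2 * n) n) ^ a ∧
        boolSum H ≠ 0 ∧
        ∀ f ∈ SmallCircuits ℂ n b,
          eval (fun e : topMonomials n => coeff (e : Fin n →₀ ℕ) f) (boolSum H) = 0 := by
  obtain ⟨q, hq, H, hHc, hHd, hne, hvan⟩ := h
  refine ⟨q, hq, H, hHc, hHd, hne, fun f hf => ?_⟩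
  obtain ⟨g, hg, hhom, hcoeff⟩ := exists_form hn f hf
  have hpt : (fun e : topMonomials n => coeff (e : Fin n →₀ ℕ) f) =
      fun e : topMonomials n => coeff (e : Fin n →₀ ℕ) g := funext fun e => (hcoeff e).symm
  rw [hpt]
  exact hvan g hg hhom

/-- **`DefinableEquations ↔` uniform equations for the varieties of small FORMS**
(through `TopEquations.definableEquations_iff`). [folklore] -/
theorem definableEquations_iff :
    Summit.ValiantsHypothesis.ValiantsHypothesis.Theses.BarrierLever.DefinableEquations ↔
      ∃ a : ℕ, ∀ b : ℕ, ∃ n₀ : ℕ, ∀ n ≥ n₀, ∃ q : ℕ, q ≤ (Nat.choose (2 * n) n) ^ a ∧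
        ∃ H : MvPolynomial (↥(topMonomials n) ⊕ Fin q) ℂ,
          complexity H ≤ (Nat.choose (2 * n) n) ^ a ∧ H.totalDegree ≤ (Nat.choose (2 * n) n) ^ a ∧
          boolSum H ≠ 0 ∧
          ∀ g ∈ SmallCircuits ℂ n b, g.IsHomogeneous n →
            eval (fun e : topMonomials n => coeff (e : Fin n →₀ ℕ) g) (boolSum H) = 0 := by
  rw [TopEquations.definableEquations_iff]
  constructor
  · rintro ⟨a, ha⟩
    refine ⟨a, fun b => ?_⟩
    obtain ⟨n₀, hn₀⟩ := ha b
    exact ⟨n₀, fun n hn => formEq_of_topEq (hn₀ n hn)⟩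
  · rintro ⟨a, ha⟩
    refine ⟨a, fun b => ?_⟩
    obtain ⟨n₀, hn₀⟩ := ha (b + 3)
    refine ⟨max n₀ 6, fun n hn => ?_⟩
    exact topEq_of_formEq (le_trans (le_max_right _ _) hn) (hn₀ n (le_trans (le_max_left _ _) hn))

end FormEquations

/-- **Registered sub-goal `definableEquations_iff_formEquations` (verbatim signature).**  The crux is
equivalent to uniform boolean-sum equations for the varieties `Forms_n(n^b)` of degree-`n` forms of
circuit size `≤ n^b` (`FormEquations.definableEquations_iff`). [folklore] -/
theorem definableEquations_iff_formEquations : Summit.ValiantsHypothesis.ValiantsHypothesis.Theses.BarrierLever.DefinableEquations ↔ ∃ a : ℕ, ∀ b : ℕ, ∃ n₀ : ℕ, ∀ n ≥ n₀, ∃ q : ℕ, q ≤ (Nat.choose (2 * n) n) ^ a ∧ ∃ H : MvPolynomial (↥(Summit.ValiantsHypothesis.ValiantsHypothesis.Theorems.BarrierLeverDefinableEquations.topMonomials n) ⊕ Fin q) ℂ, Literature.Computability.AlgebraicComplexity.complexity H ≤ (Nat.choose (2 * n) n) ^ a ∧ H.totalDegree ≤ (Nat.choose (2 * n) n) ^ a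 ∧ Literature.Computability.AlgebraicComplexity.boolSum H ≠ 0 ∧ ∀ g ∈ Literature.Barriers.ValiantsHypothesis.SmallCircuits ℂ n b, g.IsHomogeneous n → MvPolynomial.eval (fun e : ↥(Summit.ValiantsHypothesis.ValiantsHypothesis.Theorems.BarrierLeverDefinableEquations.topMonomials n) => MvPolynomial.coeff (e : Fin n →₀ ℕ) g) (Literature.Computability.AlgebraicComplexity.boolSum H) = 0 :=
  FormEquations.definableEquations_iff

end Summit.ValiantsHypothesis.ValiantsHypothesis.Theorems.BarrierLeverDefinableEquations

end
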